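import Summits.Ventures.PercRepro.RankLevelSetStarPlusNullity
import Summits.Ventures.PercRepro.RankLevelSetPerElemNullityAll
import Summits.Ventures.PercRepro.RankLevelSetAbsorbStarFourColoops
import Summits.Ventures.PercRepro.RankLevelSetBiIndepAbsorbStarClosure

/-! # RankLevelSetAbsorbNormNullityAll — (ABS-star), (★★)⁺ AND (ABS-norm) ON EVERY MATROID OF NULLITY AT MOST `3`
(night-1 g36; dossier §48.17; on `RankLevelSetStarPlusNullity`, `RankLevelSetPerElemNullityAll`,
`RankLevelSetAbsorbStarFourColoops`, `RankLevelSetBiIndepAbsorbStarClosure`)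

The simple coloop-free case is §48.14–§48.15; the rest is a JOINT strong induction on `#E` of (ABS-star) and (★★)⁺
inside the class (the dual rank never goes up under the minors, `eRank_dual_contract_delete_le` /
`eRank_dual_delete_le`): a loop empties every level (**`lowAbsorbCount_eq_zero_of_exists_loop`**); a parallel
pair reduces both to the minor `N = M ／ u ＼ v` through `absorbStar_of_parallel` and `absorbNormSkew_of_parallel`
(Mono of `N` is `biIndepMono_of_nullity`); a coloop `x` splits every level, `A^y_{j+1}(M) = A^y_j(M ＼ x) +
A^y_{j+1}(M ＼ x)` (`lowAbsorbCount_succ_of_coloop`): the (ABS-star) step is `absorbStar_step_of_coloop` below the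
middle and, AT the middle `#E = 2k + 1`, exactly the reflection `A'_{k−1} ≤ A'_{k+1}` of `M ＼ x`
(**`absorbStar_step_middle_of_coloop`**); the reflection of `M` is the sum of two reflections of `M ＼ x`
(**`starPlus_of_coloop`**). The results: **`biIndepAbsorbStar_of_nullity`**, **`biIndepStarPlus_of_nullity`**,
**`absorbNormSkew_of_nullity`** — `M✶.eRank ≤ 3 → BiIndepAbsorbStar M` / `BiIndepStarPlus M` /
`BiIndepAbsorbNormSkew M`; with `biIndepPerElem_of_nullity` and `biIndepMono_of_nullity` all five of the cell's
`Prop`s hold on every matroid of nullity `≤ 3` (**`cellProps_of_nullity`**). Every declaration has a docstring; imports: the cell's own modules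
and Mathlib only. Axioms: standard. -/

namespace PercRepro

open Set Matroid

variable {α : Type} (M : Matroid α) [M.Finite]

/-! ## The degenerate cases -/

omit [M.Finite] in
/-- **A loop anywhere empties every absorbing level** (the bi-independent sets are empty). -/
lemma lowAbsorbCount_eq_zero_of_exists_loop {ℓ : α} (hℓ : M.IsLoop ℓ) (y : α) (k : ℕ) :
    lowAbsorbCount M y k = 0 := by
  unfold lowAbsorbCount lowAbsorbAt
  rw [biIndep_eq_empty_of_isLoop M hℓ k]
  simp

/-- **At the middle `#E = 2k + 1`, the (ABS-star) step across a coloop `x` at `y ≠ x` is the reflection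
`A'_{k−1} ≤ A'_{k+1}` of `M ＼ x`** (both levels split, and the coefficients agree). -/
lemma absorbStar_step_middle_of_coloop {x y : α} (hx : M.IsColoop x) (hyx : y ≠ x) {k : ℕ} (hk : 1 ≤ k)
    (hn : M.E.ncard = 2 * k + 1)
    (h : lowAbsorbCount (M.delete {x}) y (k - 1) ≤ lowAbsorbCount (M.delete {x}) y (k + 1)) :
    (M.E.ncard - 1 - k) * lowAbsorbCount M y k ≤ k * lowAbsorbCount M y (k + 1) := by
  obtain ⟨j, rfl⟩ : ∃ j, k = j + 1 := ⟨k - 1, by omega⟩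
  rw [lowAbsorbCount_succ_of_coloop M hx hyx j, lowAbsorbCount_succ_of_coloop M hx hyx (j + 1),
    show M.E.ncard - 1 - (j + 1) = j + 1 by omega]
  simp only [Nat.add_sub_cancel] at h
  exact Nat.mul_le_mul_left _ (by omega)

/-- **The reflection of `M` across a coloop `x` at `y ≠ x` is the sum of two reflections of `M ＼ x`**
(`1 ≤ i`, `2i < #E`; at the middle of `M ＼ x` the second reflection is trivial). -/
lemma starPlus_of_coloop {x y : α} (hx : M.IsColoop x) (hyx : y ≠ x) {i : ℕ} (hi : 1 ≤ i)
    (hn : 2 * i < M.E.ncard)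
    (h1 : lowAbsorbCount (M.delete {x}) y (i - 1) ≤ lowAbsorbCount (M.delete {x}) y (M.E.ncard - 1 - (i - 1)))
    (h2 : lowAbsorbCount (M.delete {x}) y i ≤ lowAbsorbCount (M.delete {x}) y (M.E.ncard - 1 - i)) :
    lowAbsorbCount M y i ≤ lowAbsorbCount M y (M.E.ncard - i) := by
  obtain ⟨j, rfl⟩ : ∃ j, i = j + 1 := ⟨i - 1, by omega⟩
  obtain ⟨m, hm⟩ : ∃ m, M.E.ncard - (j + 1) = m + 1 := ⟨M.E.ncard - (j + 1) - 1, by omega⟩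
  rw [hm, lowAbsorbCount_succ_of_coloop M hx hyx j, lowAbsorbCount_succ_of_coloop M hx hyx m]
  simp only [Nat.add_sub_cancel] at h1
  have e1 : M.E.ncard - 1 - j = m + 1 := by omega
  have e2 : M.E.ncard - 1 - (j + 1) = m := by omega
  rw [e1] at h1
  rw [e2] at h2
  omega

/-! ## The joint induction -/

/-- **(ABS-star) AND (★★)⁺ ON EVERY MATROID OF NULLITY `≤ 3`, by a joint strong induction on `#E`** (loop,
parallel and coloop reductions; the simple coloop-free case is §48.14–§48.15). -/
theorem absorbStar_starPlus_of_nullity_aux [DecidableEq α] :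
    ∀ n : ℕ, ∀ (M' : Matroid α) [M'.Finite], M'.E.ncard = n → M'✶.eRank ≤ 3 →
      BiIndepAbsorbStar M' ∧ BiIndepStarPlus M' := by
  intro n
  induction n using Nat.strong_induction_on with
  | _ n ih =>
    intro M' _ hn hν
    -- a loop anywhere
    by_cases hloop : ∃ ℓ, M'.IsLoop ℓ
    · obtain ⟨ℓ, hℓ⟩ := hloop
      refine ⟨fun y _ k _ => ?_, fun y _ i _ => ?_⟩
      · rw [lowAbsorbCount_eq_zero_of_exists_loop M' hℓ y k, lowAbsorbCount_eq_zero_of_exists_loop M' hℓ y (k + 1)]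
        simp
      · rw [lowAbsorbCount_eq_zero_of_exists_loop M' hℓ y i, lowAbsorbCount_eq_zero_of_exists_loop M' hℓ y _]
    simp only [not_exists] at hloop
    -- a parallel pair anywhere
    by_cases hpar : ∃ u v, ParallelPair M' u v
    · obtain ⟨u, v, huv⟩ := hpar
      haveI := contract_delete_finite M' u v
      have hc := ncard_ground_contract_delete M' huv
      rw [hn] at hc
      have hνN : ((M'.contract {u}).delete {v})✶.eRank ≤ 3 :=
        le_trans (eRank_dual_contract_delete_le M' _ _) hν
      obtain ⟨hAS, hSP⟩ := ih (n - 2) (by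
        have : 2 ≤ n := by
          rw [← hn]
          exact le_trans (Set.ncard_pair huv.1).symm.le
            (Set.ncard_le_ncard (Set.pair_subset huv.2.1.mem_ground huv.2.2.1.mem_ground) M'.ground_finite)
        omega) _ hc hνN
      have hNm : BiIndepMono ((M'.contract {u}).delete {v}) :=
        biIndepMono_of_nullity _ (le_trans hνN (by norm_num))
      refine ⟨absorbStar_of_parallel M' huv hAS hNm, ?_⟩
      exact biIndepStarPlus_of_absorbNormSkew M'
        (absorbNormSkew_of_parallel M' huv (absorbNormSkew_of_absorbStar _ hAS hSP) hNm)
    simp only [not_exists] at hpar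
    -- a coloop anywhere
    by_cases hcol : ∃ x, M'.IsColoop x
    · obtain ⟨x, hx⟩ := hcol
      haveI := delete_finite' M' x
      have hcard : (M'.delete {x}).E.ncard = n - 1 := by
        rw [Matroid.delete_ground, Set.ncard_sdiff_singleton_of_mem hx.mem_ground, hn]
      have hν' : (M'.delete {x})✶.eRank ≤ 3 := le_trans (eRank_dual_delete_le M' _) hν
      have hn1 : 1 ≤ n := by rw [← hn]; exact (Set.ncard_pos M'.ground_finite).mpr ⟨x, hx.mem_ground⟩
      obtain ⟨hAS, hSP⟩ := ih (n - 1) (by omega) _ hcard hν'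
      refine ⟨fun y hy k hk => ?_, fun y hy i hi => ?_⟩
      · by_cases hyx : y = x
        · subst hyx
          rw [lowAbsorbCount_eq_zero_of_isColoop M' hx k, lowAbsorbCount_eq_zero_of_isColoop M' hx (k + 1)]
          simp
        have hyM : y ∈ (M'.delete {x}).E := by
          rw [Matroid.delete_ground]; exact ⟨hy, by simpa using hyx⟩
        rcases Nat.eq_zero_or_pos k with rfl | hk1
        · rw [lowAbsorbCount_zero M' hy]; simp
        rcases Nat.lt_or_ge (2 * k + 1) n with hlt | hge
        · refine absorbStar_step_of_coloop M' hx hyx hk1 (by omega) ?_ ?_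
          · have h := hAS y hyM (k - 1) (by omega)
            rwa [show k - 1 + 1 = k by omega] at h
          · exact hAS y hyM k (by omega)
        · refine absorbStar_step_middle_of_coloop M' hx hyx hk1 (by omega) ?_
          have := hSP y hyM (k - 1) (by omega)
          rwa [hcard, show n - 1 - (k - 1) = k + 1 by omega] at this
      · by_cases hyx : y = x
        · subst hyx
          rw [lowAbsorbCount_eq_zero_of_isColoop M' hx i, lowAbsorbCount_eq_zero_of_isColoop M' hx _]
        have hyM : y ∈ (M'.delete {x}).E := by
          rw [Matroid.delete_ground]; exact ⟨hy, by simpa using hyx⟩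
        rcases Nat.eq_zero_or_pos i with rfl | hi1
        · rw [lowAbsorbCount_zero M' hy]; exact Nat.zero_le _
        refine starPlus_of_coloop M' hx hyx hi1 (by omega) ?_ ?_
        · have := hSP y hyM (i - 1) (by omega)
          rw [hcard] at this
          rw [hn]
          exact this
        · rcases Nat.lt_or_ge (2 * i) (n - 1) with hlt | hge
          · have := hSP y hyM i (by omega)
            rw [hcard] at this
            rw [hn]
            exact this
          · have e : M'.E.ncard - 1 - i = i := by omega
            simp only [e, le_refl]
    simp only [not_exists] at hcol
    exact ⟨biIndepAbsorbStar_of_simple_coloopFree_of_nullity M' hloop hpar hcol hν,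
      biIndepStarPlus_of_simple_coloopFree_of_nullity M' hloop hpar hcol hν⟩

/-! ## The class theorems -/

/-- **(ABS-star) HOLDS ON EVERY MATROID WHOSE DUAL HAS RANK `≤ 3`** (nullity `≤ 3`). -/
theorem biIndepAbsorbStar_of_nullity [DecidableEq α] (hν : M✶.eRank ≤ 3) : BiIndepAbsorbStar M :=
  (absorbStar_starPlus_of_nullity_aux M.E.ncard M rfl hν).1

/-- **(★★)⁺ HOLDS ON EVERY MATROID WHOSE DUAL HAS RANK `≤ 3`** (nullity `≤ 3`). -/
theorem biIndepStarPlus_of_nullity [DecidableEq α] (hν : M✶.eRank ≤ 3) : BiIndepStarPlus M :=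
  (absorbStar_starPlus_of_nullity_aux M.E.ncard M rfl hν).2

/-- **(ABS-norm) HOLDS ON EVERY MATROID WHOSE DUAL HAS RANK `≤ 3`** (nullity `≤ 3`): (ABS-star) and (★★)⁺ of the
class through `absorbNormSkew_of_absorbStar`. -/
theorem absorbNormSkew_of_nullity [DecidableEq α] (hν : M✶.eRank ≤ 3) : BiIndepAbsorbNormSkew M :=
  absorbNormSkew_of_absorbStar M (biIndepAbsorbStar_of_nullity M hν) (biIndepStarPlus_of_nullity M hν)

/-- **ALL FIVE OF THE CELL'S `Prop`s HOLD ON EVERY MATROID OF NULLITY `≤ 3`**: (★★), Mono, (ABS-star), (★★)⁺ and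
(ABS-norm) (`biIndepPerElem_of_nullity` / `biIndepMono_of_nullity` need only nullity `≤ 4`). -/
theorem cellProps_of_nullity [DecidableEq α] (hν : M✶.eRank ≤ 3) :
    BiIndepPerElem M ∧ BiIndepMono M ∧ BiIndepAbsorbStar M ∧ BiIndepStarPlus M ∧ BiIndepAbsorbNormSkew M :=
  ⟨biIndepPerElem_of_nullity M (le_trans hν (by norm_num)), biIndepMono_of_nullity M (le_trans hν (by norm_num)),
    biIndepAbsorbStar_of_nullity M hν, biIndepStarPlus_of_nullity M hν, absorbNormSkew_of_nullity M hν⟩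

end PercRepro
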